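import Literature.AlgebraicGeometry.Frobenioids.FrTrFromThm51i
import Literature.AlgebraicGeometry.Frobenioids.DivisorialDescriptionsProofs
import HarnessLib

/-!
# Frobenioids I, Theorem 5.1 (iii) — conclusion (abc-iut cell, layer L1, node D-η-3)

Mochizuki, *The geometry of Frobenioids I: the general theory*, Kyushu J. Math. **62** (2008)
293–400, §5, Theorem 5.1 (iii), kurims text p. 97 [cite: MochizukiFrdI2008, Thm. 5.1 (iii) p.97]:

> "(iii) The subcategory `C^Fr-tr ⊆ C` determined by the Frobenius-trivial objects and isometric
> morphisms is a Frobenioid of isotropic, group-like, base-trivial, and `Aut`-ample type. In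
> particular, the isomorphism class of a Frobenius-trivial object of `C` is completely determined
> by the isomorphism class of its projection to `D`; all Frobenius-trivial objects of `C` are
> `Aut`-ample."

Assembly: Thm. 5.1 (i) (`thm51i_holds`, `DivisorialDescriptionsProofs.lean`, seat abc-iut-L1-t10) fed
into the reduction of (iii) to (i) (`FrTrFromThm51i.lean`) discharges every named statement of
Thm. 5.1 (iii) in `DivisorialDescriptions.lean` unconditionally ("group-like" was already
`frTr_isGroupLikeObj` there; "isotropic" is `thm51iii_isotropic` in `FrTrIsFrobenioid.lean`).
No statement of the paper is strengthened.
-/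

namespace Literature.AlgebraicGeometry.Frobenioids

namespace PreFrobenioid

open CategoryTheory

universe w v v' u u'

variable {D : Type u} [Category.{v} D] {Φ : Dᵒᵖ ⥤ CommMonCat.{w}}
  {C : Type u'} [Category.{v'} C] (F : C ⥤ ElemFrobenioid Φ)

/-- **Thm. 5.1 (iii)**: `C^Fr-tr` is a Frobenioid (for `C` a Frobenioid of isotropic type).
[cite: MochizukiFrdI2008, Thm. 5.1 (iii) p.97] -/
theorem thm51iii_isFrobenioid : Thm51iii_isFrobenioid F :=
  thm51iii_isFrobenioid_of_thm51i F (thm51i_holds F)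

/-- `Thm51iii_isFrobenioid` holds for all parameters — `_holds` alias of `thm51iii_isFrobenioid`
above (appended 2026-08-28, D-0026 bookkeeping: the proof term is the existing theorem of this
file; no statement, definition or attribute is edited; no new named fact).
[cite: MochizukiFrdI2008, Thm. 5.1 (iii) p.97] -/
theorem Thm51iii_isFrobenioid_holds : Thm51iii_isFrobenioid F :=
  thm51iii_isFrobenioid F

/-- **Thm. 5.1 (iii)**: `C^Fr-tr` is of base-trivial type. [cite: MochizukiFrdI2008, Thm. 5.1 (iii) p.97] -/
theorem thm51iii_baseTrivial : Thm51iii_baseTrivial F :=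
  thm51iii_baseTrivial_of_thm51i F (thm51i_holds F)

/-- `Thm51iii_baseTrivial` holds for all parameters — `_holds` alias of `thm51iii_baseTrivial` above
(appended 2026-08-28, D-0026 bookkeeping: the proof term is the existing theorem of this file;
no statement, definition or attribute is edited; no new named fact).
[cite: MochizukiFrdI2008, Thm. 5.1 (iii) p.97] -/
theorem Thm51iii_baseTrivial_holds : Thm51iii_baseTrivial F :=
  thm51iii_baseTrivial F

/-- **Thm. 5.1 (iii)**: `C^Fr-tr` is of `Aut`-ample type. [cite: MochizukiFrdI2008, Thm. 5.1 (iii) p.97] -/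
theorem thm51iii_autAmple : Thm51iii_autAmple F :=
  thm51iii_autAmple_of_thm51i F (thm51i_holds F)

/-- `Thm51iii_autAmple` holds for all parameters — `_holds` alias of `thm51iii_autAmple` above
(appended 2026-08-28, D-0026 bookkeeping: the proof term is the existing theorem of this file;
no statement, definition or attribute is edited; no new named fact).
[cite: MochizukiFrdI2008, Thm. 5.1 (iii) p.97] -/
theorem Thm51iii_autAmple_holds : Thm51iii_autAmple F :=
  thm51iii_autAmple F

/-- **Thm. 5.1 (iii)**, "In particular": base-isomorphic Frobenius-trivial objects of `C` are
isomorphic. [cite: MochizukiFrdI2008, Thm. 5.1 (iii) p.97] -/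
theorem thm51iii_iso_of_baseIso : Thm51iii_iso_of_baseIso F :=
  thm51iii_iso_of_baseIso_of_thm51i F (thm51i_holds F)

/-- `Thm51iii_iso_of_baseIso` holds for all parameters — `_holds` alias of `thm51iii_iso_of_baseIso`
above (appended 2026-08-28, D-0026 bookkeeping: the proof term is the existing theorem of this
file; no statement, definition or attribute is edited; no new named fact).
[cite: MochizukiFrdI2008, Thm. 5.1 (iii) p.97] -/
theorem Thm51iii_iso_of_baseIso_holds : Thm51iii_iso_of_baseIso F :=
  thm51iii_iso_of_baseIso F

/-- **Thm. 5.1 (iii)**, "In particular": all Frobenius-trivial objects of `C` are `Aut`-ample.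
[cite: MochizukiFrdI2008, Thm. 5.1 (iii) p.97] -/
theorem thm51iii_frobeniusTrivial_isAutAmple : Thm51iii_frobeniusTrivial_isAutAmple F :=
  thm51iii_frobeniusTrivial_isAutAmple_of_thm51i F (thm51i_holds F)

/-- `Thm51iii_frobeniusTrivial_isAutAmple` holds for all parameters — `_holds` alias of
`thm51iii_frobeniusTrivial_isAutAmple` above (appended 2026-08-28, D-0026 bookkeeping: the proof
term is the existing theorem of this file; no statement, definition or attribute is edited; no
new named fact).
[cite: MochizukiFrdI2008, Thm. 5.1 (iii) p.97] -/
theorem Thm51iii_frobeniusTrivial_isAutAmple_holds : Thm51iii_frobeniusTrivial_isAutAmple F :=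
  thm51iii_frobeniusTrivial_isAutAmple F

end PreFrobenioid

end Literature.AlgebraicGeometry.Frobenioids
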